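import Literature.MathematicalPhysics.QuantumFieldTheory.Balaban1983to89.B5Prop11Plancherel

/-!
# `Balaban1983to89.B5Eq129FreeResolventCycleComparison` — T. Bałaban, *Propagators and renormalization transformations for lattice gauge
# theories. I*, Commun. Math. Phys. **95** (1984) 17–40 [Balaban1984PropagatorsI] (1.29) p. 23 (free lattice operators; here d = 1): **COMPARISON
# PRINCIPLES FOR THE RESOLVENT EQUATION ON THE CYCLE `ℤ∕n` — supersolutions are nonnegative; a subsolution with point source `S·δ₀` lies below `S`
# times the solution; the solution is nonnegative and decreasing in the mass** — the comparison half of the WEIGHTED ∇-row (P-J-1b) of the pub-balaban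
# NE9 chain's storey J (row L13 of `t4/ROUTES-NE9.md`; t4-ne9-idea-1 g129's `cycle_supersolution_nonneg` ∕ `cycle_subsolution_le` ∕ `cycle_solution_nonneg`,
# Mathlib-only scratch under FREEZE (0), here in the tree's (FS) `t²`-encoding); companion of `B5Eq129FreeResolventCycleProfile` (the solution in closed form)

statement-level skeleton of published theorems with citation tags; proofs where landed; nothing here is a claim about the Yang–Mills mass gap

CITATION HEADER (lean-in-tree rule).  Audit cell `pub-balaban`, sub-cell `t4`, BINDER row NE9; filed by NE9 crux-team LEAF PROVER 05
(`b2b-balaban-t4-ne9-formalise-leaf-05`, gen 80).  OBJECT: the d = 1 case of [Balaban1984PropagatorsI] (1.29) p. 23's free stencil on Mathlib's `ZMod n`,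
equations ∕ inequalities `t²[(w(s) − w(s−1)) + (w(s) − w(s+1))] + μ·w(s) ⋚ …` as HYPOTHESES (no `def`).  CONTENT: [folklore] discrete minimum principle
([DodziukMathai2006] Lemma 1.1 is the graph form).  Mathematics: t4-ne9-idea-1 g129 `t4/ideate/NE9/lens1-g129/lean/PJ1Bcycle_g129.NOT-TO-FILE.lean`
l.1342–1430 (credit); this file is its tree typing.  Nothing of [B5′] is asserted.

WHAT IS PROVED (sorry-free; proof lane — 0 `def`).
* **`cycle_nonneg_of_supersolution`**, **`cycle_le_mul_of_subsolution`** (`K ≤ S·G`), `cycle_solution_nonneg`, `cycle_solution_le_of_mass_le`.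
HONEST SCOPE.  Elementary; `μ > 0`.  ONE step of ONE letter of ONE un-opened storey (J) of row L13; NOT the ∇-line of (3.42), NOT Tier P, NOT NE9 (cell
pub-balaban: NE9 NOT PRINTED ∕ NOT PROVED; «NE9 ⇐ the named binders»; row WALLED ON A MODEL (O-NE9-1; #5 UNRULED); spine PROVED 0∕9; rung (B)+1 finite T⁴ —
NOT infinite volume, NOT mass gap, NOT BetaPertH, NOT Clay).  HONEST DEPENDENCY: continuum YM on T⁴ ⇐ BetaPertH ∧ nine spine estimates (0/9 proved); BetaPertH
⇐ (D1) ∧ (D4) ∧ CAP+tail; G-an2-4 gates asym, D1 and NE2/3/4.  NEW file importing `B5Prop11Plancherel` only (Mathlib closure); nothing modified.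
Net new unproved facts: 0.
-/

noncomputable section

open scoped BigOperators

namespace Literature.MathematicalPhysics.QuantumFieldTheory.Balaban1983to89.B5Eq129FreeResolventCycleComparison

variable {n : ℕ} [NeZero n]

/-- **MINIMUM PRINCIPLE ON THE CYCLE (supersolutions are nonnegative).**  If `t²[(w(s) − w(s−1)) + (w(s) − w(s+1))] + μ·w(s) ≥ 0` at every
`s ∈ ℤ∕n` and `μ > 0`, then `w ≥ 0` (at a minimiser both brackets are `≤ 0`). [folklore] [cite: Balaban1984PropagatorsI, (1.29) p.23] -/
theorem cycle_nonneg_of_supersolution (t : ℝ) {μ : ℝ} (hμ : 0 < μ) {w : ZMod n → ℝ}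
    (h : ∀ s, 0 ≤ t ^ 2 * ((w s - w (s - 1)) + (w s - w (s + 1))) + μ * w s) (s : ZMod n) : 0 ≤ w s := by
  obtain ⟨s₀, -, hmin⟩ := Finset.exists_min_image Finset.univ w (Finset.univ_nonempty (α := ZMod n))
  have h1 := hmin (s₀ - 1) (Finset.mem_univ _)
  have h2 := hmin (s₀ + 1) (Finset.mem_univ _)
  have hbr : t ^ 2 * ((w s₀ - w (s₀ - 1)) + (w s₀ - w (s₀ + 1))) ≤ 0 :=
    mul_nonpos_iff.mpr (Or.inl ⟨sq_nonneg t, by linarith⟩)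
  have h0 : 0 ≤ w s₀ := by
    by_contra hneg
    have : μ * w s₀ < 0 := mul_neg_of_pos_of_neg hμ (lt_of_not_ge hneg)
    linarith [h s₀]
  exact h0.trans (hmin s (Finset.mem_univ _))

/-- **COMPARISON: a subsolution with a point source lies below the corresponding multiple of the solution.**  On `ℤ∕n` with `μ > 0`: if
`t²[(K(s) − K(s−1)) + (K(s) − K(s+1))] + μ·K(s) ≤ S·δ_{s,0}` and `t²[(G(s) − G(s−1)) + (G(s) − G(s+1))] + μ·G(s) = δ_{s,0}`, then `K ≤ S·G`
(the minimum principle applied to `S·G − K`).  With `B5Eq129FreeResolventCycleProfile.cycle_profile_eq` the right-hand side is explicit.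
[folklore] [cite: Balaban1984PropagatorsI, (1.29) p.23] -/
theorem cycle_le_mul_of_subsolution (t : ℝ) {μ : ℝ} (hμ : 0 < μ) {K G : ZMod n → ℝ} (S : ℝ)
    (hK : ∀ s, t ^ 2 * ((K s - K (s - 1)) + (K s - K (s + 1))) + μ * K s ≤ if s = 0 then S else 0)
    (hG : ∀ s, t ^ 2 * ((G s - G (s - 1)) + (G s - G (s + 1))) + μ * G s = if s = 0 then 1 else 0) (s : ZMod n) :
    K s ≤ S * G s := by
  have hw : ∀ s, 0 ≤ t ^ 2 * (((S * G s - K s) - (S * G (s - 1) - K (s - 1))) + ((S * G s - K s) - (S * G (s + 1) - K (s + 1)))) +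
      μ * (S * G s - K s) := by
    intro s
    have e : t ^ 2 * (((S * G s - K s) - (S * G (s - 1) - K (s - 1))) + ((S * G s - K s) - (S * G (s + 1) - K (s + 1)))) +
        μ * (S * G s - K s) = S * (t ^ 2 * ((G s - G (s - 1)) + (G s - G (s + 1))) + μ * G s) -
          (t ^ 2 * ((K s - K (s - 1)) + (K s - K (s + 1))) + μ * K s) := by ring
    rw [e, hG s]
    have := hK s
    split_ifs at this ⊢ <;> linarith
  have := cycle_nonneg_of_supersolution t hμ hw s
  linarith

/-- **THE SOLUTION IS NONNEGATIVE AND MONOTONE IN THE MASS.**  (i) `G ≥ 0` for the solution with source `δ₀`; (ii) if `0 < μ′ ≤ μ` then the mass-`μ`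
solution lies below the mass-`μ′` solution pointwise (it is a subsolution at mass `μ′` with source `δ₀`, since `(μ − μ′)G ≥ 0`).
[folklore] [cite: Balaban1984PropagatorsI, (1.29) p.23] -/
theorem cycle_solution_nonneg (t : ℝ) {μ : ℝ} (hμ : 0 < μ) {G : ZMod n → ℝ}
    (hG : ∀ s, t ^ 2 * ((G s - G (s - 1)) + (G s - G (s + 1))) + μ * G s = if s = 0 then 1 else 0) (s : ZMod n) : 0 ≤ G s :=
  cycle_nonneg_of_supersolution t hμ (fun s => by rw [hG s]; split_ifs <;> norm_num) s

/-- see `cycle_solution_nonneg`: monotonicity of the cycle resolvent in the mass. [folklore] [cite: Balaban1984PropagatorsI, (1.29) p.23] -/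
theorem cycle_solution_le_of_mass_le (t : ℝ) {μ μ' : ℝ} (hμ' : 0 < μ') (hle : μ' ≤ μ) {G G' : ZMod n → ℝ}
    (hG : ∀ s, t ^ 2 * ((G s - G (s - 1)) + (G s - G (s + 1))) + μ * G s = if s = 0 then 1 else 0)
    (hG' : ∀ s, t ^ 2 * ((G' s - G' (s - 1)) + (G' s - G' (s + 1))) + μ' * G' s = if s = 0 then 1 else 0) (s : ZMod n) :
    G s ≤ G' s := by
  have hpos := cycle_solution_nonneg t (lt_of_lt_of_le hμ' hle) hG
  have hK : ∀ s, t ^ 2 * ((G s - G (s - 1)) + (G s - G (s + 1))) + μ' * G s ≤ if s = 0 then (1 : ℝ) else 0 := by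
    intro s
    rw [← hG s]
    have := mul_le_mul_of_nonneg_right hle (hpos s)
    linarith
  have := cycle_le_mul_of_subsolution t hμ' 1 hK hG' s
  linarith

end Literature.MathematicalPhysics.QuantumFieldTheory.Balaban1983to89.B5Eq129FreeResolventCycleComparison

end
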